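import Mathlib.Analysis.Calculus.FDeriv.Comp
import Literature.AlgebraicGeometry.HodgeTheory.AbelianVarietyCotangentDifferential
import Literature.NumberTheory.Transcendental.AnalytificationChartsProofs
import Literature.RingTheory.Smooth.CotangentDimensionAtRationalPoint
import HarnessLib

/-!
# An analytically unramified morphism of smooth complex varieties is unramified (GAGA at a point)

Topic `Literature/NumberTheory/Transcendental`, namespace `Literature.NumberTheory.Transcendental`.
THEOREMS ONLY.

Let `f : X ⟶ Y` be a morphism of smooth `ℂ`-schemes (`SmoothOfRelativeDimension n X.hom`,
`SmoothOfRelativeDimension m Y.hom`), `φ : M → X(ℂ)` and `ψ : M' → Y(ℂ)` analytifications by complex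
manifolds (`IsAnalytification`, Serre's `X^h`), and `fᵃⁿ : M → M'` a holomorphic map over `f`
(`ψ ∘ fᵃⁿ = f(ℂ) ∘ φ`).  For `p ∈ M` over the closed point `x = pt(φ p)` with image `y = f x`:

* `IsAnalytification.stalkDifferential_stalkMap` — **chain rule**: the differential at `p` of the
  germ `f^* t` (`t` regular near `y`) is the differential of `t` at `fᵃⁿ p` composed with
  `T_p fᵃⁿ = mfderiv fᵃⁿ p`.
* `IsAnalytification.mem_sq_maximalIdeal_of_stalkDifferential_eq_zero` — **the differential at `p`
  detects `𝔪_x/𝔪_x²`**: a germ `h ∈ 𝔪_x` whose differential at `p` vanishes lies in `𝔪_x²`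
  (`dim_ℂ 𝔪/𝔪² = n` at a rational point of a standard smooth chart,
  `Literature.RingTheory.Smooth.mem_sq_of_apply_eq_zero`, and the differentials of regular
  functions span `E^*`, `IsAnalytification.exists_rational_cotangentFrame`).
* `IsAnalytification.maximalIdeal_le_map_stalkMap_sup_sq_of_injective_mfderiv` — **if `T_p fᵃⁿ` is
  injective then `𝔪_x ⊆ 𝔪_y·𝒪_{X,x} + 𝔪_x²`**, i.e. `𝔪_y → 𝔪_x/𝔪_x²` is onto: the algebraic half
  of «an immersion of complex manifolds is unramified» (with Nakayama,
  `Literature.RingTheory.Etale.map_maximalIdeal_eq_of_le_sup_sq`, it gives `𝔪_y 𝒪_{X,x} = 𝔪_x`).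

This is the pointwise content of GAGA for unramified morphisms: `f` is unramified at `x` iff
`fᵃⁿ` is an immersion at `p` (SGA 1, Exp. XII, Prop. 3.1 (iv)–(v); Serre, GAGA §2 n°6 Prop. 3
Cor. 2 for `𝔪_x/𝔪_x² = (T_p M)^*`).

## References

* [SGA1] A. Grothendieck, M. Raynaud, *Revêtements étales et groupe fondamental (SGA 1)*, LNM 224
  (1971), Exp. XII, Prop. 3.1. [SGA1]
* [SerreGAGA1956] J.-P. Serre, *Géométrie algébrique et géométrie analytique*, Ann. Inst. Fourier 6
  (1956), §2 n°5 Prop. 2, n°6 Prop. 3 Cor. 2.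
* [Grothendieck1967] A. Grothendieck, *EGA IV₄*, Publ. Math. IHÉS 32 (1967), Cor. 17.4.2,
  Prop. 17.2.5.
-/

noncomputable section

universe u

open CategoryTheory AlgebraicGeometry Topology Filter TopologicalSpace Opposite
open scoped Manifold ContDiff
open Literature.AlgebraicGeometry.Motives (AlgPoints ComplexPoints SchemeOver)
open Literature.AlgebraicGeometry.Motives.AlgPoints

namespace Literature.NumberTheory.Transcendental

namespace IsAnalytification

/-! ### §1  The chain rule for the differential of a germ -/

section ChainRule

variable {E : Type*} [NormedAddCommGroup E] [NormedSpace ℂ E] [FiniteDimensional ℂ E]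
  {M : Type*} [TopologicalSpace M] [ChartedSpace E M]
  {E' : Type*} [NormedAddCommGroup E'] [NormedSpace ℂ E'] [FiniteDimensional ℂ E']
  {M' : Type*} [TopologicalSpace M'] [ChartedSpace E' M']

omit [FiniteDimensional ℂ E] [FiniteDimensional ℂ E'] in
/-- For charted spaces modelled on complex vector spaces (`𝓘(ℂ, E)`), `mfderiv` at `p` of a map
differentiable at `p` is the Fréchet derivative of the map read in the preferred charts at `p` and
`g p`. [folklore] -/
private theorem mfderiv_eq_fderiv_chart {g : M → M'} {p : M}
    (hg : MDifferentiableAt 𝓘(ℂ, E) 𝓘(ℂ, E') g p) :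
    mfderiv 𝓘(ℂ, E) 𝓘(ℂ, E') g p =
      fderiv ℂ (fun z ↦ chartAt E' (g p) (g ((chartAt E p).symm z))) (chartAt E p p) := by
  rw [hg.mfderiv]
  simp only [writtenInExtChartAt, extChartAt_coe, extChartAt_coe_symm, modelWithCornersSelf_coe,
    modelWithCornersSelf_coe_symm, Function.comp_def, id_eq, Set.range_id, fderivWithin_univ]

omit [FiniteDimensional ℂ E] [FiniteDimensional ℂ E'] in
/-- The map read in the preferred charts is differentiable at `χ p` when the map is
`MDifferentiableAt p`. [folklore] -/
private theorem differentiableAt_chart_of_mdifferentiableAt {g : M → M'} {p : M}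
    (hg : MDifferentiableAt 𝓘(ℂ, E) 𝓘(ℂ, E') g p) :
    DifferentiableAt ℂ (fun z ↦ chartAt E' (g p) (g ((chartAt E p).symm z))) (chartAt E p p) := by
  have h := ((mdifferentiableAt_iff g p).1 hg).2
  simp only [writtenInExtChartAt, extChartAt_coe, extChartAt_coe_symm, modelWithCornersSelf_coe,
    modelWithCornersSelf_coe_symm, Function.comp_def, id_eq, Set.range_id,
    differentiableWithinAt_univ] at h
  exact h

variable {X Y : SchemeOver ℂ} {n m : ℕ} {φ : M → ComplexPoints X} {ψ : M' → ComplexPoints Y}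

/-- `evalOrZero` is compatible with pull-back along a morphism, at every point (both sides vanish
off the open). [folklore] -/
private theorem evalOrZero_app_eq (f : X ⟶ Y) (U : Y.left.Opens) (t : Γ(Y.left, U)) (R : ComplexPoints X) :
    evalOrZero (f.left ⁻¹ᵁ U) (f.left.app U t) R = evalOrZero U t (AlgPoints.map f R) := by
  by_cases hR : R.pt ∈ f.left ⁻¹ᵁ U
  · rw [evalOrZero_of_mem _ hR, evalOrZero_of_mem t (show (AlgPoints.map f R).pt ∈ U from hR),
      AlgPoints.eval_map]
  · rw [evalOrZero_of_not_mem _ hR, evalOrZero_of_not_mem]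
    exact hR

omit [FiniteDimensional ℂ E] in
/-- **Chain rule for the differential of a germ.**  With `D_X` the differential at `p` on the
stalk `𝒪_{X,x}` (`x = pt(φ p)`) and `D_Y` the differential at `fᵃⁿ p` on `𝒪_{Y,y}` (`y = f x`),
for every regular `t` near `y`: `D_X (f^* t) = D_Y (t) ∘ T_p fᵃⁿ`.
[cite: SerreGAGA1956, §2 n°5 Prop. 2] -/
theorem stalkDifferential_stalkMap [IsManifold 𝓘(ℂ, E') ω M']
    (hψ : IsAnalytification E' Y m ψ) (f : X ⟶ Y)
    (fan : M → M') (hcomm : ∀ q, ψ (fan q) = AlgPoints.map f (φ q)) (p : M)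
    (hfan : MDifferentiableAt 𝓘(ℂ, E) 𝓘(ℂ, E') fan p)
    {x : X.left} (hx : (φ p).pt = x) {y : Y.left} (hy : f.left.base x = y)
    (DX : X.left.presheaf.stalk x →+ (E →L[ℂ] ℂ))
    (hDX : ∀ (U : X.left.Opens) (hU : x ∈ U) (s : Γ(X.left, U)),
      DX (X.left.presheaf.germ U x hU s) =
        fderiv ℂ (fun z ↦ evalOrZero U s (φ ((chartAt E p).symm z))) (chartAt E p p))
    (DY : Y.left.presheaf.stalk y →+ (E' →L[ℂ] ℂ))
    (hDY : ∀ (U : Y.left.Opens) (hU : y ∈ U) (t : Γ(Y.left, U)),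
      DY (Y.left.presheaf.germ U y hU t) =
        fderiv ℂ (fun u ↦ evalOrZero U t (ψ ((chartAt E' (fan p)).symm u)))
          (chartAt E' (fan p) (fan p)))
    (U : Y.left.Opens) (hU : y ∈ U) (t : Γ(Y.left, U)) :
    DX ((f.left.stalkMap x).hom
        (Y.left.presheaf.germ U (f.left.base x) (hy ▸ hU) t)) =
      (DY (Y.left.presheaf.germ U y hU t)).comp (mfderiv 𝓘(ℂ, E) 𝓘(ℂ, E') fan p) := by
  subst hx hy
  rw [Scheme.Hom.germ_stalkMap_apply, hDX, hDY, mfderiv_eq_fderiv_chart hfan]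
  -- the two functions agree near `χ p`
  set χ := chartAt E p with hχ
  set χ' := chartAt E' (fan p) with hχ'
  have hfanp : fan p ∈ χ'.source := mem_chart_source E' (fan p)
  have hcont : ContinuousAt fan p := ((mdifferentiableAt_iff fan p).1 hfan).1
  have hEq : (fun z ↦ evalOrZero (f.left ⁻¹ᵁ U) (f.left.app U t) (φ (χ.symm z))) =ᶠ[𝓝 (χ p)]
      (fun u ↦ evalOrZero U t (ψ (χ'.symm u))) ∘ (fun z ↦ χ' (fan (χ.symm z))) := by
    -- `χ.symm z ∈ fan ⁻¹' χ'.source` near `χ p`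
    have h1 : χ.target ∩ χ.symm ⁻¹' (fan ⁻¹' χ'.source) ∈ 𝓝 (χ p) := by
      refine Filter.inter_mem (χ.open_target.mem_nhds (χ.map_source (mem_chart_source E p))) ?_
      refine (χ.continuousAt_symm (χ.map_source (mem_chart_source E p))).preimage_mem_nhds ?_
      rw [χ.left_inv (mem_chart_source E p)]
      exact hcont.preimage_mem_nhds (χ'.open_source.mem_nhds hfanp)
    filter_upwards [h1] with z hz
    simp only [Function.comp_apply]
    rw [evalOrZero_app_eq, ← hcomm, χ'.left_inv hz.2]
  rw [hEq.fderiv_eq]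
  have hU' : (ψ (fan p)).pt ∈ U := by rw [hcomm p]; exact hU
  have hG : DifferentiableAt ℂ (fun u ↦ evalOrZero U t (ψ (χ'.symm u))) (χ' (fan p)) :=
    (hasFDerivAt_evalOrZero_chart hψ (fan p) U t hU').differentiableAt
  have hF : DifferentiableAt ℂ (fun z ↦ χ' (fan (χ.symm z))) (χ p) :=
    differentiableAt_chart_of_mdifferentiableAt hfan
  have hval : χ' (fan (χ.symm (χ p))) = χ' (fan p) := by rw [χ.left_inv (mem_chart_source E p)]
  have hG' : DifferentiableAt ℂ (fun u ↦ evalOrZero U t (ψ (χ'.symm u)))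
      (χ' (fan (χ.symm (χ p)))) := by rw [hval]; exact hG
  rw [fderiv_comp (χ p) hG' hF, hval]
  rfl

end ChainRule

/-! ### §2  The differential at `p` detects `𝔪_x / 𝔪_x²` -/

section Detect

variable {E : Type*} [NormedAddCommGroup E] [NormedSpace ℂ E] [FiniteDimensional ℂ E]
  {M : Type*} [TopologicalSpace M] [ChartedSpace E M] [IsManifold 𝓘(ℂ, E) ω M]
  {X : SchemeOver ℂ} {n : ℕ} {φ : M → ComplexPoints X}

/-- The differential at `p` kills `𝔪_x²` (Leibniz at a zero). [cite: SerreGAGA1956, §2 n°5 Prop. 2] -/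
theorem stalkDifferential_eq_zero_of_mem_sq (hφ : IsAnalytification E X n φ) (P : M) {x : X.left}
    (hx : (φ P).pt = x) (D : X.left.presheaf.stalk x →+ (E →L[ℂ] ℂ))
    (hD : ∀ (U : X.left.Opens) (hU : x ∈ U) (s : Γ(X.left, U)),
      D (X.left.presheaf.germ U x hU s) =
        fderiv ℂ (fun z ↦ evalOrZero U s (φ ((chartAt E P).symm z))) (chartAt E P P))
    {a : X.left.presheaf.stalk x}
    (ha : a ∈ IsLocalRing.maximalIdeal (X.left.presheaf.stalk x) ^ 2) : D a = 0 := by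
  rw [pow_two] at ha
  refine Submodule.mul_induction_on ha (fun b hb c hc ↦ ?_) (fun b c hb hc ↦ ?_)
  · exact stalkDifferential_mul_eq_zero hφ P hx D hD hb hc
  · rw [map_add, hb, hc, add_zero]

/-- **Leibniz with an arbitrary factor**: for `h ∈ 𝔪_x` and a regular `s` near `x`,
`D (h · s) = s(x) · D h`. [cite: SerreGAGA1956, §2 n°5 Prop. 2] -/
theorem stalkDifferential_mul_germ (hφ : IsAnalytification E X n φ) (P : M) {x : X.left}
    (hx : (φ P).pt = x) (D : X.left.presheaf.stalk x →+ (E →L[ℂ] ℂ))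
    (hD : ∀ (U : X.left.Opens) (hU : x ∈ U) (s : Γ(X.left, U)),
      D (X.left.presheaf.germ U x hU s) =
        fderiv ℂ (fun z ↦ evalOrZero U s (φ ((chartAt E P).symm z))) (chartAt E P P))
    {h : X.left.presheaf.stalk x} (hh : h ∈ IsLocalRing.maximalIdeal (X.left.presheaf.stalk x))
    (U : X.left.Opens) (hU : x ∈ U) (s : Γ(X.left, U)) :
    D (h * X.left.presheaf.germ U x hU s) = evalOrZero U s (φ P) • D h := by
  obtain ⟨hmem, -⟩ := stalkDifferential_sub_value hφ P hx D hD U hU s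
  set c : ℂ := evalOrZero U s (φ P) with hc
  set κ := X.left.presheaf.map (homOfLE (le_top : U ≤ ⊤)).op
    (X.hom.appTop ((Scheme.ΓSpecIso (.of ℂ)).inv c)) with hκ
  have hκg : X.left.presheaf.germ U x hU κ =
      X.left.presheaf.germ ⊤ x trivial (X.hom.appTop ((Scheme.ΓSpecIso (.of ℂ)).inv c)) := by
    rw [hκ, TopCat.Presheaf.germ_res_apply]
  have hsplit : X.left.presheaf.germ U x hU s =
      X.left.presheaf.germ U x hU (s - κ) + X.left.presheaf.germ U x hU κ := by
    rw [map_sub, sub_add_cancel]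
  rw [hsplit, mul_add, map_add, stalkDifferential_mul_eq_zero hφ P hx D hD hh hmem, zero_add,
    mul_comm, hκg, stalkDifferential_const_mul hφ P hx D hD c h]

/-- `dim_ℂ E^* = dim_ℂ E` (finite-dimensional). [folklore] -/
private theorem finrank_dual_clm' :
    Module.finrank ℂ (E →L[ℂ] ℂ) = Module.finrank ℂ E := by
  rw [← (LinearMap.toContinuousLinearMap : (E →ₗ[ℂ] ℂ) ≃ₗ[ℂ] (E →L[ℂ] ℂ)).finrank_eq]
  exact Subspace.dual_finrank_eq

/-- **The differentials of germs vanishing at `x` exhaust `E^*`** (GAGA at a point: the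
differentials of regular functions span the cotangent space of the manifold).
[cite: SerreGAGA1956, §2 n°6 Prop. 3 Cor. 2] -/
theorem exists_mem_maximalIdeal_stalkDifferential_eq [LocallyOfFiniteType X.hom]
    [SmoothOfRelativeDimension n X.hom] (hφ : IsAnalytification E X n φ) (P : M) {x : X.left}
    (hx : (φ P).pt = x) (D : X.left.presheaf.stalk x →+ (E →L[ℂ] ℂ))
    (hD : ∀ (U : X.left.Opens) (hU : x ∈ U) (s : Γ(X.left, U)),
      D (X.left.presheaf.germ U x hU s) =
        fderiv ℂ (fun z ↦ evalOrZero U s (φ ((chartAt E P).symm z))) (chartAt E P P))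
    (w : E →L[ℂ] ℂ) :
    ∃ a ∈ IsLocalRing.maximalIdeal (X.left.presheaf.stalk x), D a = w := by
  classical
  obtain ⟨ℓ, -, hspan, hℓ, -⟩ := exists_rational_cotangentFrame (k := ℂ) hφ (P := P)
    (fun U hU s ↦ ⟨(φ P).eval U hU s, by rw [Algebra.algebraMap_self, RingHom.id_apply]⟩)
  -- each frame vector is the differential of a germ in `𝔪_x`
  have hℓ' : ∀ i, ∃ a ∈ IsLocalRing.maximalIdeal (X.left.presheaf.stalk x), D a = ℓ i := by
    intro i
    obtain ⟨U, s, hPU, hDs⟩ := hℓ i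
    have hU : x ∈ U := hx ▸ hPU
    obtain ⟨hmem, hval⟩ := stalkDifferential_sub_value hφ P hx D hD U hU s
    exact ⟨_, hmem, by rw [hval, hDs.fderiv]⟩
  choose a ha hDa using hℓ'
  obtain ⟨c, rfl⟩ := (Submodule.mem_span_range_iff_exists_fun ℂ).1 (hspan (Submodule.mem_top : w ∈ ⊤))
  refine ⟨∑ i, X.left.presheaf.germ ⊤ x trivial
      (X.hom.appTop ((Scheme.ΓSpecIso (.of ℂ)).inv (c i))) * a i, ?_, ?_⟩
  · exact Ideal.sum_mem _ fun i _ ↦ Ideal.mul_mem_left _ _ (ha i)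
  · rw [map_sum]
    exact Finset.sum_congr rfl fun i _ ↦ by
      rw [stalkDifferential_const_mul hφ P hx D hD (c i) (a i), hDa]

omit [FiniteDimensional ℂ E] [ChartedSpace E M] [IsManifold 𝓘(ℂ, E) ω M] [TopologicalSpace M] in
/-- A germ lies in `𝔪_x` iff it is not a unit; a section whose germ is a unit does not vanish at
the point. [folklore] -/
private theorem evalOrZero_ne_zero_of_isUnit_germ (P : M) {x : X.left} (hx : (φ P).pt = x)
    {U : X.left.Opens} (hU : x ∈ U) (s : Γ(X.left, U))
    (hs : IsUnit (X.left.presheaf.germ U x hU s)) : evalOrZero U s (φ P) ≠ 0 := by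
  intro h0
  have hmem : X.left.presheaf.germ U x hU s ∈ IsLocalRing.maximalIdeal _ :=
    (germ_mem_maximalIdeal_iff (φ := φ) P hx hU s).2 h0
  exact (IsLocalRing.mem_maximalIdeal _ |>.1 hmem) hs

/-- **The differential at `p` detects `𝔪_x/𝔪_x²`.**  For a smooth `ℂ`-scheme `X` of relative
dimension `n` with analytification `φ : M → X(ℂ)` (holomorphic atlas), `p ∈ M` over `x`, and the
differential `D` at `p` on `𝒪_{X,x}`: a germ `h ∈ 𝔪_x` with `D h = 0` lies in `𝔪_x²`.  Proof: on a
standard smooth affine chart `V ∋ x` (`Γ(X, V)` standard smooth of relative dimension `n` over `ℂ`),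
`g ↦ D(germ g)` is a `ℂ`-linear map on the augmentation ideal of the point, killing its square and
onto `E^*` (`exists_mem_maximalIdeal_stalkDifferential_eq`), and `dim E^* = n = dim 𝔪/𝔪²`
(`Literature.RingTheory.Smooth.mem_sq_of_apply_eq_zero`); the stalk is a localisation of `Γ(X, V)`.
[cite: SerreGAGA1956, §2 n°6 Prop. 3 Cor. 2] [cite: Grothendieck1967, IV₄ Cor. 17.15.9] -/
theorem mem_sq_maximalIdeal_of_stalkDifferential_eq_zero [LocallyOfFiniteType X.hom]
    [SmoothOfRelativeDimension n X.hom] (hφ : IsAnalytification E X n φ) (P : M) {x : X.left}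
    (hx : (φ P).pt = x) (D : X.left.presheaf.stalk x →+ (E →L[ℂ] ℂ))
    (hD : ∀ (U : X.left.Opens) (hU : x ∈ U) (s : Γ(X.left, U)),
      D (X.left.presheaf.germ U x hU s) =
        fderiv ℂ (fun z ↦ evalOrZero U s (φ ((chartAt E P).symm z))) (chartAt E P P))
    {h : X.left.presheaf.stalk x} (hh : h ∈ IsLocalRing.maximalIdeal (X.left.presheaf.stalk x))
    (hDh : D h = 0) : h ∈ IsLocalRing.maximalIdeal (X.left.presheaf.stalk x) ^ 2 := by
  classical
  subst hx
  -- a standard smooth affine chart at `x`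
  obtain ⟨V, hV, hPV, hstd⟩ :=
    AlgPoints.exists_isStandardSmoothOfRelativeDimension_scalarRingHom n (φ P)
  letI alg : Algebra ℂ Γ(X.left, V) := (SchemeOver.scalarRingHom X V).toAlgebra
  haveI : Algebra.IsStandardSmoothOfRelativeDimension n ℂ Γ(X.left, V) := hstd.toAlgebra
  -- the stalk is a localisation of `Γ(X, V)`
  letI : Algebra Γ(X.left, V) (X.left.presheaf.stalk (φ P).pt) :=
    TopCat.Presheaf.algebra_section_stalk X.left.presheaf ⟨(φ P).pt, hPV⟩
  haveI hloc : IsLocalization.AtPrime (X.left.presheaf.stalk (φ P).pt)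
      (hV.primeIdealOf ⟨(φ P).pt, hPV⟩).asIdeal := hV.isLocalization_stalk ⟨(φ P).pt, hPV⟩
  set 𝔭 := (hV.primeIdealOf ⟨(φ P).pt, hPV⟩).asIdeal with h𝔭
  have hgermalg : ∀ g : Γ(X.left, V), algebraMap Γ(X.left, V) (X.left.presheaf.stalk (φ P).pt) g =
      X.left.presheaf.germ V (φ P).pt hPV g := fun g ↦ rfl
  -- the rational point `e = ev_x : Γ(X, V) →ₐ[ℂ] ℂ`
  let e : Γ(X.left, V) →ₐ[ℂ] ℂ :=
    { toRingHom := (φ P).evalRingHom V hPV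
      commutes' := fun c ↦ by
        rw [RingHom.algebraMap_toAlgebra, Algebra.algebraMap_self, RingHom.id_apply]
        exact AlgPoints.eval_scalarRingHom (φ P) hPV c }
  have he : ∀ g, e g = (φ P).eval V hPV g := fun g ↦ rfl
  have hmemI : ∀ g : Γ(X.left, V), g ∈ RingTheory.Smooth.augIdeal e ↔
      X.left.presheaf.germ V (φ P).pt hPV g ∈ IsLocalRing.maximalIdeal _ := by
    intro g
    rw [germ_mem_maximalIdeal_iff (φ := φ) P rfl hPV g, evalOrZero_of_mem g hPV, ← he]
    exact RingHom.mem_ker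
  -- the `ℂ`-linear map `g ↦ D (germ g)` on the augmentation ideal
  have hsmul : ∀ (c : ℂ) (g : Γ(X.left, V)), D (X.left.presheaf.germ V (φ P).pt hPV (c • g)) =
      c • D (X.left.presheaf.germ V (φ P).pt hPV g) := by
    intro c g
    rw [Algebra.smul_def, map_mul, RingHom.algebraMap_toAlgebra]
    have hconst : X.left.presheaf.germ V (φ P).pt hPV (SchemeOver.scalarRingHom X V c) =
        X.left.presheaf.germ ⊤ (φ P).pt trivial (X.hom.appTop ((Scheme.ΓSpecIso (.of ℂ)).inv c)) := by
      rw [SchemeOver.scalarRingHom_apply, Scheme.Hom.appLE, CommRingCat.comp_apply,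
        TopCat.Presheaf.germ_res_apply]
      rfl
    rw [hconst, stalkDifferential_const_mul hφ P rfl D hD c]
  let L : ↥(RingTheory.Smooth.augIdeal e) →ₗ[ℂ] (E →L[ℂ] ℂ) :=
    { toFun := fun g ↦ D (X.left.presheaf.germ V (φ P).pt hPV (g : Γ(X.left, V)))
      map_add' := fun g g' ↦ by rw [Submodule.coe_add, map_add, map_add]
      map_smul' := fun c g ↦ by rw [RingHom.id_apply, Submodule.coe_smul_of_tower, hsmul] }
  have hL : ∀ g : ↥(RingTheory.Smooth.augIdeal e),
      L g = D (X.left.presheaf.germ V (φ P).pt hPV (g : Γ(X.left, V))) := fun g ↦ rfl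
  -- `L` kills the square of the augmentation ideal
  have hL2 : ∀ g : ↥(RingTheory.Smooth.augIdeal e),
      (g : Γ(X.left, V)) ∈ RingTheory.Smooth.augIdeal e ^ 2 → L g = 0 := by
    intro g hg
    rw [hL]
    refine stalkDifferential_eq_zero_of_mem_sq hφ P rfl D hD ?_
    have hmap : (RingTheory.Smooth.augIdeal e).map
        (X.left.presheaf.germ V (φ P).pt hPV).hom ≤ IsLocalRing.maximalIdeal _ := by
      rw [Ideal.map_le_iff_le_comap]
      intro g' hg'
      exact (hmemI g').1 hg'
    have := Ideal.pow_right_mono (n := 2) hmap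
    rw [← Ideal.map_pow] at this
    exact this (Ideal.mem_map_of_mem _ hg)
  -- `L` is onto `E^*`
  have hLsurj : Function.Surjective L := by
    intro w
    obtain ⟨a, ha, hDa⟩ := exists_mem_maximalIdeal_stalkDifferential_eq hφ P rfl D hD w
    obtain ⟨⟨g, s⟩, hgs⟩ := IsLocalization.mk'_surjective 𝔭.primeCompl a
    -- `germ g = a * germ s`, `germ s` a unit
    have hunit : IsUnit (X.left.presheaf.germ V (φ P).pt hPV (s : Γ(X.left, V))) := by
      rw [← hgermalg]; exact IsLocalization.map_units _ s
    have hgerm : X.left.presheaf.germ V (φ P).pt hPV g =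
        a * X.left.presheaf.germ V (φ P).pt hPV (s : Γ(X.left, V)) := by
      rw [← hgermalg, ← hgermalg, ← hgs, IsLocalization.mk'_spec]
    set σ : ℂ := evalOrZero V (s : Γ(X.left, V)) (φ P) with hσ
    have hσ0 : σ ≠ 0 := evalOrZero_ne_zero_of_isUnit_germ P rfl hPV _ hunit
    have hgI : g ∈ RingTheory.Smooth.augIdeal e := by
      rw [hmemI, hgerm]
      exact Ideal.mul_mem_right _ _ ha
    refine ⟨σ⁻¹ • ⟨g, hgI⟩, ?_⟩
    rw [_root_.map_smul, hL, Subtype.coe_mk, hgerm, stalkDifferential_mul_germ hφ P rfl D hD ha V hPV,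
      hDa, ← hσ, smul_smul, inv_mul_cancel₀ hσ0, one_smul]
  -- dimension count: `dim E^* = n`
  have hW : Module.finrank ℂ (E →L[ℂ] ℂ) = n := by rw [finrank_dual_clm', hφ.finrank_eq]
  -- now the given `h`: write `h = germ g / germ s`
  obtain ⟨⟨g, s⟩, hgs⟩ := IsLocalization.mk'_surjective 𝔭.primeCompl h
  have hunit : IsUnit (X.left.presheaf.germ V (φ P).pt hPV (s : Γ(X.left, V))) := by
    rw [← hgermalg]; exact IsLocalization.map_units _ s
  have hgerm : X.left.presheaf.germ V (φ P).pt hPV g =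
      h * X.left.presheaf.germ V (φ P).pt hPV (s : Γ(X.left, V)) := by
    rw [← hgermalg, ← hgermalg, ← hgs, IsLocalization.mk'_spec]
  have hgI : g ∈ RingTheory.Smooth.augIdeal e := by
    rw [hmemI, hgerm]
    exact Ideal.mul_mem_right _ _ hh
  have hLg : L ⟨g, hgI⟩ = 0 := by
    rw [hL, Subtype.coe_mk, hgerm, stalkDifferential_mul_germ hφ P rfl D hD hh V hPV, hDh]
    ext v
    simp only [FunLike.coe_smul, Pi.smul_apply, FunLike.coe_zero, Pi.zero_apply, smul_zero]
  have hg2 : g ∈ RingTheory.Smooth.augIdeal e ^ 2 :=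
    RingTheory.Smooth.mem_sq_of_apply_eq_zero e hW L hL2 hLsurj hLg
  -- push to the stalk
  have hmap : (RingTheory.Smooth.augIdeal e).map
      (X.left.presheaf.germ V (φ P).pt hPV).hom ≤ IsLocalRing.maximalIdeal _ := by
    rw [Ideal.map_le_iff_le_comap]
    intro g' hg'
    exact (hmemI g').1 hg'
  have hgerm2 : X.left.presheaf.germ V (φ P).pt hPV g ∈ IsLocalRing.maximalIdeal _ ^ 2 := by
    have := Ideal.pow_right_mono (n := 2) hmap
    rw [← Ideal.map_pow] at this
    exact this (Ideal.mem_map_of_mem _ hg2)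
  obtain ⟨u, hu⟩ := hunit
  have hh' : h = X.left.presheaf.germ V (φ P).pt hPV g * ↑u⁻¹ := by
    rw [hgerm, ← hu, Units.mul_inv_cancel_right]
  rw [hh']
  exact Ideal.mul_mem_right _ _ hgerm2

end Detect

/-! ### §3  An injective differential forces `𝔪_x ⊆ 𝔪_y 𝒪_{X,x} + 𝔪_x²` -/

section Main

variable {E : Type*} [NormedAddCommGroup E] [NormedSpace ℂ E] [FiniteDimensional ℂ E]
  {M : Type*} [TopologicalSpace M] [ChartedSpace E M] [IsManifold 𝓘(ℂ, E) ω M]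
  {E' : Type*} [NormedAddCommGroup E'] [NormedSpace ℂ E'] [FiniteDimensional ℂ E']
  {M' : Type*} [TopologicalSpace M'] [ChartedSpace E' M'] [IsManifold 𝓘(ℂ, E') ω M']
  {X Y : SchemeOver ℂ} {n m : ℕ} {φ : M → ComplexPoints X} {ψ : M' → ComplexPoints Y}

omit [FiniteDimensional ℂ E] in
/-- Transpose of an injective linear map between finite-dimensional spaces is onto: every
functional on `E` factors through an injective `A : E → E'`. [folklore] -/
private theorem exists_comp_eq_of_injective (A : E →L[ℂ] E') (hA : Function.Injective A)
    (w : E →L[ℂ] ℂ) : ∃ w' : E' →L[ℂ] ℂ, w'.comp A = w := by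
  obtain ⟨g, hg⟩ := LinearMap.exists_leftInverse_of_injective (A : E →ₗ[ℂ] E')
    (LinearMap.ker_eq_bot.2 hA)
  refine ⟨LinearMap.toContinuousLinearMap ((w : E →ₗ[ℂ] ℂ).comp g), ?_⟩
  ext v
  have := LinearMap.congr_fun hg v
  simp only [LinearMap.coe_comp, Function.comp_apply, ContinuousLinearMap.coe_coe,
    LinearMap.id_coe, id_eq] at this
  simp [this]

/-- **An analytically unramified point is unramified (cotangent form).**  Let `f : X ⟶ Y` be a
morphism of smooth `ℂ`-schemes, `φ`, `ψ` analytifications of `X`, `Y` with holomorphic atlases,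
`fᵃⁿ : M → M'` a map over `f` (`ψ ∘ fᵃⁿ = f(ℂ) ∘ φ`) which is differentiable at `p` with INJECTIVE
differential `T_p fᵃⁿ`.  Then at `x = pt(φ p)`, `y = f x`:
`𝔪_x ⊆ 𝔪_y·𝒪_{X,x} + 𝔪_x²`, i.e. `𝔪_y → 𝔪_x/𝔪_x²` is onto.  (Proof: for `g ∈ 𝔪_x`, `D_X g ∈ E^*`
is `w' ∘ T_p fᵃⁿ` for some `w' ∈ E'^*` (injectivity), `w' = D_Y b` with `b ∈ 𝔪_y`
(`exists_mem_maximalIdeal_stalkDifferential_eq`), so `D_X (g - f^* b) = 0` by the chain rule and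
`g - f^* b ∈ 𝔪_x²` by `mem_sq_maximalIdeal_of_stalkDifferential_eq_zero`.)  With Nakayama
(`Literature.RingTheory.Etale.map_maximalIdeal_eq_of_le_sup_sq`) this is `𝔪_y 𝒪_{X,x} = 𝔪_x`,
i.e. `f` is unramified at `x` — SGA 1 XII Prop. 3.1: `f` is unramified iff `fᵃⁿ` is.
[cite: SGA1, Exp. XII Prop. 3.1 (iv)] [cite: SerreGAGA1956, §2 n°6 Prop. 3 Cor. 2] -/
theorem maximalIdeal_le_map_stalkMap_sup_sq_of_injective_mfderiv
    [LocallyOfFiniteType X.hom] [SmoothOfRelativeDimension n X.hom]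
    [LocallyOfFiniteType Y.hom] [SmoothOfRelativeDimension m Y.hom]
    (hφ : IsAnalytification E X n φ) (hψ : IsAnalytification E' Y m ψ) (f : X ⟶ Y)
    (fan : M → M') (hcomm : ∀ q, ψ (fan q) = AlgPoints.map f (φ q)) (p : M)
    (hfan : MDifferentiableAt 𝓘(ℂ, E) 𝓘(ℂ, E') fan p)
    (hinj : Function.Injective (mfderiv 𝓘(ℂ, E) 𝓘(ℂ, E') fan p))
    {x : X.left} (hx : (φ p).pt = x) :
    IsLocalRing.maximalIdeal (X.left.presheaf.stalk x) ≤
      (IsLocalRing.maximalIdeal (Y.left.presheaf.stalk (f.left.base x))).map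
          (f.left.stalkMap x).hom ⊔
        IsLocalRing.maximalIdeal (X.left.presheaf.stalk x) ^ 2 := by
  subst hx
  obtain ⟨DX, hDX⟩ := exists_stalkDifferential hφ p
  have hy : (ψ (fan p)).pt = f.left.base (φ p).pt := by rw [hcomm p]; rfl
  obtain ⟨DY, hDY⟩ := exists_stalkDifferential_of_eq hψ (fan p) hy
  intro g hg
  -- `D_X g = w' ∘ T_p fᵃⁿ`
  obtain ⟨w', hw'⟩ := exists_comp_eq_of_injective (E := E) (E' := E')
    (mfderiv 𝓘(ℂ, E) 𝓘(ℂ, E') fan p) hinj (DX g)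
  -- `w' = D_Y b`, `b ∈ 𝔪_y`
  obtain ⟨b, hb, hDb⟩ :=
    exists_mem_maximalIdeal_stalkDifferential_eq hψ (fan p) hy DY hDY w'
  obtain ⟨U, hU, t, rfl⟩ := Y.left.presheaf.exists_germ_eq b
  set T := (f.left.stalkMap (φ p).pt).hom (Y.left.presheaf.germ U _ hU t) with hTdef
  have hT : T ∈ (IsLocalRing.maximalIdeal (Y.left.presheaf.stalk (f.left.base (φ p).pt))).map
      (f.left.stalkMap (φ p).pt).hom := Ideal.mem_map_of_mem _ hb
  have hTm : T ∈ IsLocalRing.maximalIdeal (X.left.presheaf.stalk (φ p).pt) := by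
    rw [IsLocalRing.mem_maximalIdeal, mem_nonunits_iff, hTdef, isUnit_map_iff]
    exact (IsLocalRing.mem_maximalIdeal _).1 hb
  -- chain rule: `D_X T = D_Y b ∘ T_p fᵃⁿ = D_X g`
  have hDT : DX T = DX g := by
    rw [hTdef, stalkDifferential_stalkMap hψ f fan hcomm p hfan rfl rfl DX hDX DY hDY U hU t, hDb]
    exact hw'
  have h0 : DX (g - T) = 0 := by rw [map_sub, hDT, sub_self]
  have h2 : g - T ∈ IsLocalRing.maximalIdeal (X.left.presheaf.stalk (φ p).pt) ^ 2 :=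
    mem_sq_maximalIdeal_of_stalkDifferential_eq_zero hφ p rfl DX hDX (sub_mem hg hTm) h0
  exact Submodule.mem_sup.2 ⟨T, hT, g - T, h2, add_sub_cancel T g⟩

end Main

end IsAnalytification

end Literature.NumberTheory.Transcendental
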